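import Summits.CriticalPhenomena.PercolationContinuityZ3.Theorems.PercNearOneGluingNoHeavyLowerTailOneCutFiveCondTwoPoint
import Mathlib.Tactic.Linarith
import Mathlib.Tactic.Ring
import HarnessLib

/-!
# `NoHeavyLowerTail` (stmt-CriticalPhenomena-4575) — normal forms of the conditional two-point row V3MAX (`OneCutFive.CondTwoPoint`):
# the scale-free form LIN-H, the DECOUPLED form CORE, and the dual two-point lemma

Support file (prover seat `prim-ineq-gen-8`, gen 7; `--supports stmt-CriticalPhenomena-4575 --as helper`; memo
`run/shared/lean/prim/prim-ineq-gen-8/FINDING-gen7-CORE.md`).  Two `@[conjecture]` definitions, no named facts, no sorries.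
HONEST LABEL: crux 4575 is CLOSED (CSH route, p205010); the `|A| = 5` glued rung is independent mathematics / the insurance line.
`CondTwoPoint`, `LinH`, `CoreHalf` below are OPEN (equivalent to one another on paper, census-clean) and nothing here asserts them.

`μ = prodBernoulli w` on `Fin n`, observer `o`, vertices `a, b, c`, `q_v = μ(o ↔ v)`, `x = μ(o↔a, o↮b)`, `y = μ(o↔b, o↮a)`,
`d_ac = μ(o↔a, o↮b, o↔c)`, `d_bc = μ(o↮a, o↔b, o↔c)`, `s_a = x − d_ac`, `s_b = y − d_bc`,
`γ_a = P(o↔c | o↔a, o↮b) = d_ac/x`, `γ_b = d_bc/y`.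

* `OneCutFive.LinH` — the scale-free form of V3MAX (a5-a2, V3MAX-NOTES §2 (R2)): `q_c ≥ m := max(½, q_a, q_b)` ⟹
  `m·(y·d_ac + x·d_bc) ≥ q_c·x·y`, i.e. `γ_a + γ_b ≥ q_c/m`.
* `OneCutFive.CoreHalf` — the DECOUPLED form (one hypothesis per vertex): `q_a ≤ ½`, `q_b ≤ ½`, `q_c ≥ ½` ⟹
  `y·d_ac + x·d_bc ≥ 2 q_c·x·y`, i.e. `P(o↔c | o↔a, o↮b) + P(o↔c | o↔b, o↮a) ≥ 2 P(o↔c)`.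
* PROVED here (pure bookkeeping): `condTwoPoint_of_linH : LinH → CondTwoPoint` and `coreHalf_of_linH : LinH → CoreHalf`.
  On paper (memo §1, elementary leaf tricks) also `CoreHalf → LinH` (hang a pendant observer `o′` on `o` with weight
  `1/(2 max(q_a,q_b))`: every `o`-cell scales by that weight) and `CondTwoPoint → LinH` (hang a pendant `c′` on `c`, a5-a2 (R2)),
  so the three statements are EQUIVALENT over all finite weighted graphs; those two directions need a change of vertex type and are
  not formalized here.
* PROVED here: `dualTwoPoint_sum_le` — the `b`-free case of the stronger product form PROD-C of the memo
  (`q_a ≤ ½`, `q_a ≤ q_c` ⟹ `P(o↔a | o↔c) + P(o↔a | o↮c) ≤ 1`, division-free), the mirror image of a5-a2's `twoPoint_prod_le`.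

Why the decoupled form matters (memo §1(v), §4): `CoreHalf` is an EQUALITY on every graph in which `c`'s `G∖o`-component avoids
`a, b` (all stars, any parameters) and on every `b`-independent graph with `q_a = ½`; hence no certificate with law-polynomial
multipliers exists, and the proof must use `G ∖ o` structure (gluing transitivity; Gladkov-type no-jump constraints).
-/

noncomputable section

namespace Summit.CriticalPhenomena.PercolationContinuityZ3.Theorems

open MeasureTheory Set Literature.Probability.LatticeModels Literature.Probability.Percolation
open scoped Classical BigOperators

namespace OneCutFive

variable {n : ℕ}

/-! ### The two normal forms (conjectures) -/

/-- **LIN-H, the scale-free form of V3MAX (CONJECTURE).**  For distinct `o, a, b, c` with `q_c ≥ m := max(½, q_a, q_b)`: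
`m·(y·d_ac + x·d_bc) ≥ q_c·x·y`, i.e. `P(o↔c | o↔a, o↮b) + P(o↔c | o↔b, o↮a) ≥ q_c / m` (a5-a2 V3MAX-NOTES §2 (R2): equivalent to
`CondTwoPoint` by hanging a pendant leaf on `c`; equivalent to `CoreHalf` by hanging a pendant observer on `o`).  OPEN, census-clean.
[this work] [status: open] -/
@[conjecture] def LinH : Prop :=
  ∀ (n : ℕ) (w : Sym2 (Fin n) → unitInterval) (o a b c : Fin n),
    o ≠ a → o ≠ b → o ≠ c → a ≠ b → a ≠ c → b ≠ c →
    (prodBernoulli w).real (openConn o a) ≤ (prodBernoulli w).real (openConn o c) →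
    (prodBernoulli w).real (openConn o b) ≤ (prodBernoulli w).real (openConn o c) →
    1 / 2 ≤ (prodBernoulli w).real (openConn o c) →
    (prodBernoulli w).real (openConn o c) *
        ((prodBernoulli w).real {ω : BondConfig (Fin n) | ω ∈ openConn o a ∧ ω ∉ openConn o b} *
          (prodBernoulli w).real {ω : BondConfig (Fin n) | ω ∈ openConn o b ∧ ω ∉ openConn o a}) ≤
      max (1 / 2) (max ((prodBernoulli w).real (openConn o a)) ((prodBernoulli w).real (openConn o b))) *
        ((prodBernoulli w).real {ω : BondConfig (Fin n) | ω ∈ openConn o b ∧ ω ∉ openConn o a} *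
            (prodBernoulli w).real {ω : BondConfig (Fin n) | ω ∈ openConn o a ∧ ω ∉ openConn o b ∧ ω ∈ openConn o c} +
          (prodBernoulli w).real {ω : BondConfig (Fin n) | ω ∈ openConn o a ∧ ω ∉ openConn o b} *
            (prodBernoulli w).real {ω : BondConfig (Fin n) | ω ∉ openConn o a ∧ ω ∈ openConn o b ∧ ω ∈ openConn o c})

/-- **CORE, the decoupled form (CONJECTURE).**  For distinct `o, a, b, c` with `q_a ≤ ½`, `q_b ≤ ½`, `q_c ≥ ½`:
`y·d_ac + x·d_bc ≥ 2 q_c·x·y`, i.e. `P(o↔c | o↔a, o↮b) + P(o↔c | o↔b, o↮a) ≥ 2 P(o↔c)`: conditioning on the two DISCORDANT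
worlds does not, on average, decrease the probability that `o` reaches `c`.  One hypothesis per vertex.  Equality whenever the
`G∖o`-component of `c` avoids `a` and `b` (all stars), and whenever `b` is independent of `(a,c)` with `q_a = ½`.  OPEN,
census-clean (memo §2: 0 violations, random and annealed). [this work] [status: open] -/
@[conjecture] def CoreHalf : Prop :=
  ∀ (n : ℕ) (w : Sym2 (Fin n) → unitInterval) (o a b c : Fin n),
    o ≠ a → o ≠ b → o ≠ c → a ≠ b → a ≠ c → b ≠ c →
    (prodBernoulli w).real (openConn o a) ≤ 1 / 2 →
    (prodBernoulli w).real (openConn o b) ≤ 1 / 2 →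
    1 / 2 ≤ (prodBernoulli w).real (openConn o c) →
    2 * (prodBernoulli w).real (openConn o c) *
        ((prodBernoulli w).real {ω : BondConfig (Fin n) | ω ∈ openConn o a ∧ ω ∉ openConn o b} *
          (prodBernoulli w).real {ω : BondConfig (Fin n) | ω ∈ openConn o b ∧ ω ∉ openConn o a}) ≤
      (prodBernoulli w).real {ω : BondConfig (Fin n) | ω ∈ openConn o b ∧ ω ∉ openConn o a} *
          (prodBernoulli w).real {ω : BondConfig (Fin n) | ω ∈ openConn o a ∧ ω ∉ openConn o b ∧ ω ∈ openConn o c} +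
        (prodBernoulli w).real {ω : BondConfig (Fin n) | ω ∈ openConn o a ∧ ω ∉ openConn o b} *
          (prodBernoulli w).real {ω : BondConfig (Fin n) | ω ∉ openConn o a ∧ ω ∈ openConn o b ∧ ω ∈ openConn o c}

/-! ### LIN-H implies V3MAX and CORE (bookkeeping) -/

/-- From `m(y d_ac + x d_bc) ≥ q_c x y` with `0 < m ≤ q_c`: `y d_ac + x d_bc ≥ x y`. [this work] -/
theorem sum_ge_prod_of_linH_ineq {m q x y dac dbc : ℝ} (hm : 0 < m) (hmq : m ≤ q) (hx : 0 ≤ x) (hy : 0 ≤ y)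
    (h : q * (x * y) ≤ m * (y * dac + x * dbc)) : x * y ≤ y * dac + x * dbc := by
  have hxy : 0 ≤ x * y := mul_nonneg hx hy
  have h1 : m * (x * y) ≤ q * (x * y) := mul_le_mul_of_nonneg_right hmq hxy
  have h2 : m * (x * y) ≤ m * (y * dac + x * dbc) := h1.trans h
  exact le_of_mul_le_mul_left h2 hm

/-- The exchange algebra behind V3MAX: with `x = s_a + d_ac`, `y = s_b + d_bc` and `x y ≤ y d_ac + x d_bc`,
`s_a s_b ≤ d_ac d_bc`. [this work] -/
theorem prod_le_of_sum_ge_prod {sa sb dac dbc : ℝ}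
    (h : (sa + dac) * (sb + dbc) ≤ (sb + dbc) * dac + (sa + dac) * dbc) : sa * sb ≤ dac * dbc := by
  nlinarith [h]

/-- **LIN-H ⟹ V3MAX (`CondTwoPoint`).**  Under `q_c ≥ m = max(½,q_a,q_b) > 0`, LIN-H gives `y d_ac + x d_bc ≥ x y`, and with
`x = s_a + d_ac`, `y = s_b + d_bc` this is `s_a s_b ≤ d_ac d_bc`. [this work] -/
theorem condTwoPoint_of_linH (hL : LinH) : CondTwoPoint := by
  intro n w o a b c hoa hob hoc hab hac hbc hqac hqbc hhalf
  set μ := prodBernoulli w with hμ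
  have key := hL n w o a b c hoa hob hoc hab hac hbc hqac hqbc hhalf
  set qa := μ.real (openConn o a) with hqa
  set qb := μ.real (openConn o b) with hqb
  set qc := μ.real (openConn o c) with hqc
  set x := μ.real {ω : BondConfig (Fin n) | ω ∈ openConn o a ∧ ω ∉ openConn o b} with hx
  set y := μ.real {ω : BondConfig (Fin n) | ω ∈ openConn o b ∧ ω ∉ openConn o a} with hy
  set sa := μ.real {ω : BondConfig (Fin n) | ω ∈ openConn o a ∧ ω ∉ openConn o b ∧ ω ∉ openConn o c} with hsa
  set sb := μ.real {ω : BondConfig (Fin n) | ω ∉ openConn o a ∧ ω ∈ openConn o b ∧ ω ∉ openConn o c} with hsb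
  set dac := μ.real {ω : BondConfig (Fin n) | ω ∈ openConn o a ∧ ω ∉ openConn o b ∧ ω ∈ openConn o c} with hdac
  set dbc := μ.real {ω : BondConfig (Fin n) | ω ∉ openConn o a ∧ ω ∈ openConn o b ∧ ω ∈ openConn o c} with hdbc
  set m := max (1 / 2 : ℝ) (max qa qb) with hm
  have hm0 : 0 < m := lt_of_lt_of_le (by norm_num) (le_max_left _ _)
  have hmq : m ≤ qc := max_le hhalf (max_le hqac hqbc)
  have hx0 : 0 ≤ x := measureReal_nonneg
  have hy0 : 0 ≤ y := measureReal_nonneg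
  have hsum : x * y ≤ y * dac + x * dbc := sum_ge_prod_of_linH_ineq hm0 hmq hx0 hy0 key
  -- `x = s_a + d_ac`, `y = s_b + d_bc`
  have hxsplit : x = sa + dac := real_conn_notConn_split μ o a b c
  have hysplit : y = sb + dbc := by
    have h := real_conn_notConn_split μ o b a c
    have e1 : {ω : BondConfig (Fin n) | ω ∈ openConn o b ∧ ω ∉ openConn o a ∧ ω ∉ openConn o c} =
        {ω : BondConfig (Fin n) | ω ∉ openConn o a ∧ ω ∈ openConn o b ∧ ω ∉ openConn o c} := by
      ext ω; simp only [mem_setOf_eq]; tauto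
    have e2 : {ω : BondConfig (Fin n) | ω ∈ openConn o b ∧ ω ∉ openConn o a ∧ ω ∈ openConn o c} =
        {ω : BondConfig (Fin n) | ω ∉ openConn o a ∧ ω ∈ openConn o b ∧ ω ∈ openConn o c} := by
      ext ω; simp only [mem_setOf_eq]; tauto
    rw [e1, e2] at h
    exact h
  rw [hxsplit, hysplit] at hsum
  exact prod_le_of_sum_ge_prod hsum

/-- **LIN-H ⟹ CORE.**  When `q_a, q_b ≤ ½ ≤ q_c` the scale is `m = ½` and LIN-H reads `½ (y d_ac + x d_bc) ≥ q_c x y`.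
[this work] -/
theorem coreHalf_of_linH (hL : LinH) : CoreHalf := by
  intro n w o a b c hoa hob hoc hab hac hbc hqa hqb hhalf
  have hqac : (prodBernoulli w).real (openConn o a) ≤ (prodBernoulli w).real (openConn o c) := hqa.trans hhalf
  have hqbc : (prodBernoulli w).real (openConn o b) ≤ (prodBernoulli w).real (openConn o c) := hqb.trans hhalf
  have key := hL n w o a b c hoa hob hoc hab hac hbc hqac hqbc hhalf
  have hm : max (1 / 2 : ℝ) (max ((prodBernoulli w).real (openConn o a)) ((prodBernoulli w).real (openConn o b))) = 1 / 2 :=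
    max_eq_left (max_le hqa hqb)
  rw [hm] at key
  linarith

/-- **V3MAX from LIN-H, in the POCKET form used downstream**: LIN-H ⟹ (POCKET-½) (via `pocketHalf_of_condTwoPoint`).
[this work] -/
theorem pocketHalf_of_linH (hL : LinH) :
    ∀ (n : ℕ) (w : Sym2 (Fin n) → unitInterval) (o a b c : Fin n),
      o ≠ a → o ≠ b → o ≠ c → a ≠ b → a ≠ c → b ≠ c →
      1 / 2 ≤ (prodBernoulli w).real (openConn o a) →
      (prodBernoulli w).real (openConn o a) ≤ (prodBernoulli w).real (openConn o b) →
      (prodBernoulli w).real (openConn o a) ≤ (prodBernoulli w).real (openConn o c) →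
      (prodBernoulli w).real {ω : BondConfig (Fin n) | ω ∈ openConn o a ∧ ω ∉ openConn o b ∧ ω ∉ openConn o c} ≤
        (prodBernoulli w).real {ω : BondConfig (Fin n) | ω ∉ openConn o a ∧ ω ∈ openConn o b ∧ ω ∈ openConn o c} :=
  pocketHalf_of_condTwoPoint (condTwoPoint_of_linH hL)

/-! ### The dual two-point lemma (the `b`-free case of the product form PROD-C) -/

/-- `μ(X) = μ(X ∩ Y) + μ(X ∩ Yᶜ)` on the finite configuration space. [folklore] -/
private theorem real_eq_inter_add_inter_compl (μ : Measure (BondConfig (Fin n))) [IsProbabilityMeasure μ]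
    (X Y : Set (BondConfig (Fin n))) : μ.real X = μ.real (X ∩ Y) + μ.real (X ∩ Yᶜ) := by
  rw [← Set.sdiff_eq]
  exact (measureReal_inter_add_sdiff (μ := μ) (s := X) MeasurableSet.of_discrete).symm

/-- **Dual two-point lemma (PROVED).**  If `q_a ≤ ½` and `q_a ≤ q_c` then
`μ(o↔a, o↔c)·μ(o↮c) + μ(o↔a, o↮c)·μ(o↔c) ≤ μ(o↔c)·μ(o↮c)`, i.e. `P(o↔a | o↔c) + P(o↔a | o↮c) ≤ 1`.
With `u = μ(a,c)`, `p = q_a`, `r = q_c` the claim is `u(1−2r) ≤ r(1−r−p)`: for `r ≤ ½` use `u ≤ p ≤ r`; for `r ≥ ½` use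
Harris `u ≥ pr` and `p ≤ ½`.  Mirror image of `twoPoint_prod_le`; it is the case "`b` independent of `(a,c)`" of the product
form PROD-C of the memo (`P(A∖B|C)·P(B∖A|C) ≥ P(A∖B|C̄)·P(B∖A|C̄)`). [this work] -/
theorem dualTwoPoint_sum_le (w : Sym2 (Fin n) → unitInterval) (o a c : Fin n)
    (hhalf : (prodBernoulli w).real (openConn o a) ≤ 1 / 2)
    (hac : (prodBernoulli w).real (openConn o a) ≤ (prodBernoulli w).real (openConn o c)) :
    (prodBernoulli w).real (openConn o a ∩ openConn o c) * (prodBernoulli w).real (openConn o c)ᶜ +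
        (prodBernoulli w).real (openConn o a ∩ (openConn o c)ᶜ) * (prodBernoulli w).real (openConn o c) ≤
      (prodBernoulli w).real (openConn o c) * (prodBernoulli w).real (openConn o c)ᶜ := by
  set μ := prodBernoulli w with hμ
  have hmeas : ∀ s : Set (BondConfig (Fin n)), MeasurableSet s := fun _ => MeasurableSet.of_discrete
  set A : Set (BondConfig (Fin n)) := openConn o a with hA
  set C : Set (BondConfig (Fin n)) := openConn o c with hC
  have hpA : μ.real A = μ.real (A ∩ C) + μ.real (A ∩ Cᶜ) := real_eq_inter_add_inter_compl μ A C
  have hcomplC : μ.real C + μ.real Cᶜ = 1 := by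
    rw [measureReal_add_measureReal_compl (hmeas C), probReal_univ]
  have hHarris : μ.real A * μ.real C ≤ μ.real (A ∩ C) :=
    prodBernoulli_harris w (isUpperSet_openConn o a) (isUpperSet_openConn o c) (hmeas _) (hmeas _)
  have huA : μ.real (A ∩ C) ≤ μ.real A := measureReal_mono Set.inter_subset_left
  have h0 : 0 ≤ μ.real (A ∩ C) := measureReal_nonneg
  have h0' : 0 ≤ μ.real (A ∩ Cᶜ) := measureReal_nonneg
  have hC1 : μ.real C ≤ 1 := measureReal_le_one
  have hC0 : 0 ≤ μ.real C := measureReal_nonneg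
  have hCc : μ.real Cᶜ = 1 - μ.real C := by linarith
  have hACc : μ.real (A ∩ Cᶜ) = μ.real A - μ.real (A ∩ C) := by linarith
  rw [hCc, hACc]
  by_cases hr : μ.real C ≤ 1 / 2
  · -- `u ≤ p ≤ r`, `1 - 2r ≥ 0`:  `u(1-2r) ≤ p(1-2r) ≤ r(1-r-p)`
    nlinarith [huA, hac, hr, mul_nonneg (sub_nonneg.2 huA) (by linarith : (0:ℝ) ≤ 1 - 2 * μ.real C),
      mul_nonneg (sub_nonneg.2 hac) (by linarith : (0:ℝ) ≤ 1 - μ.real C)]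
  · push Not at hr
    -- `u ≥ p r`, `p ≤ ½`, `2r - 1 ≥ 0`:  `u(1-2r) ≤ pr(1-2r) ≤ r(1-r-p)`
    nlinarith [hHarris, hhalf, hr, mul_nonneg (sub_nonneg.2 hHarris) (by linarith : (0:ℝ) ≤ 2 * μ.real C - 1),
      mul_nonneg (mul_nonneg hC0 (by linarith : (0:ℝ) ≤ 1 - μ.real C)) (by linarith : (0:ℝ) ≤ 1 - 2 * μ.real A)]

/-- **Dual two-point lemma, product form**: under the same hypotheses
`μ(a,c)·μ(ā,c)·μ(c̄)² ≥ μ(a,c̄)·μ(ā,c̄)·μ(c)²` (`t(1−t)` is increasing on `[0,½]`: with `t₁ = P(a|c) ≥ t₀ = P(a|c̄)` (Harris) and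
`t₀ + t₁ ≤ 1` (the sum form), `t₁(1−t₁) ≥ t₀(1−t₀)`). [this work] -/
theorem dualTwoPoint_prod_le (w : Sym2 (Fin n) → unitInterval) (o a c : Fin n)
    (hhalf : (prodBernoulli w).real (openConn o a) ≤ 1 / 2)
    (hac : (prodBernoulli w).real (openConn o a) ≤ (prodBernoulli w).real (openConn o c)) :
    (prodBernoulli w).real (openConn o a ∩ (openConn o c)ᶜ) * (prodBernoulli w).real ((openConn o a)ᶜ ∩ (openConn o c)ᶜ) *
        (prodBernoulli w).real (openConn o c) ^ 2 ≤
      (prodBernoulli w).real (openConn o a ∩ openConn o c) * (prodBernoulli w).real ((openConn o a)ᶜ ∩ openConn o c) *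
        (prodBernoulli w).real (openConn o c)ᶜ ^ 2 := by
  have hsum := dualTwoPoint_sum_le w o a c hhalf hac
  set μ := prodBernoulli w with hμ
  have hmeas : ∀ s : Set (BondConfig (Fin n)), MeasurableSet s := fun _ => MeasurableSet.of_discrete
  set A : Set (BondConfig (Fin n)) := openConn o a with hA
  set C : Set (BondConfig (Fin n)) := openConn o c with hC
  have hpA : μ.real A = μ.real (A ∩ C) + μ.real (A ∩ Cᶜ) := real_eq_inter_add_inter_compl μ A C
  have hrC : μ.real C = μ.real (C ∩ A) + μ.real (C ∩ Aᶜ) := real_eq_inter_add_inter_compl μ C A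
  have hrCc : μ.real Cᶜ = μ.real (Cᶜ ∩ A) + μ.real (Cᶜ ∩ Aᶜ) := real_eq_inter_add_inter_compl μ Cᶜ A
  have e1 : C ∩ A = A ∩ C := Set.inter_comm _ _
  have e2 : C ∩ Aᶜ = Aᶜ ∩ C := Set.inter_comm _ _
  have e3 : Cᶜ ∩ A = A ∩ Cᶜ := Set.inter_comm _ _
  have e4 : Cᶜ ∩ Aᶜ = Aᶜ ∩ Cᶜ := Set.inter_comm _ _
  rw [e1, e2] at hrC
  rw [e3, e4] at hrCc
  have hHarris : μ.real A * μ.real C ≤ μ.real (A ∩ C) :=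
    prodBernoulli_harris w (isUpperSet_openConn o a) (isUpperSet_openConn o c) (hmeas _) (hmeas _)
  have hcomplC : μ.real C + μ.real Cᶜ = 1 := by
    rw [measureReal_add_measureReal_compl (hmeas C), probReal_univ]
  have h0 : 0 ≤ μ.real (A ∩ C) := measureReal_nonneg
  have h0' : 0 ≤ μ.real (A ∩ Cᶜ) := measureReal_nonneg
  have h1 : 0 ≤ μ.real (Aᶜ ∩ C) := measureReal_nonneg
  have h1' : 0 ≤ μ.real (Aᶜ ∩ Cᶜ) := measureReal_nonneg
  have hC0 : 0 ≤ μ.real C := measureReal_nonneg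
  have hCc0 : 0 ≤ μ.real Cᶜ := measureReal_nonneg
  have hCc : μ.real Cᶜ = 1 - μ.real C := by linarith
  have hACc : μ.real (A ∩ Cᶜ) = μ.real A - μ.real (A ∩ C) := by linarith
  have hAcC : μ.real (Aᶜ ∩ C) = μ.real C - μ.real (A ∩ C) := by linarith
  have hAcCc : μ.real (Aᶜ ∩ Cᶜ) = 1 - μ.real C - (μ.real A - μ.real (A ∩ C)) := by linarith
  -- Harris in the form `u·μ(Cᶜ) ≥ μ(A ∩ Cᶜ)·μ(C)` (i.e. `t₁ ≥ t₀`): `α := u(1-r) ≥ β := (p-u) r`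
  have ht : (μ.real A - μ.real (A ∩ C)) * μ.real C ≤ μ.real (A ∩ C) * (1 - μ.real C) := by nlinarith [hHarris]
  -- the sum form: `α + β ≤ r(1-r)`
  have hs : μ.real (A ∩ C) * (1 - μ.real C) + (μ.real A - μ.real (A ∩ C)) * μ.real C ≤ μ.real C * (1 - μ.real C) := by
    rw [hCc, hACc] at hsum; exact hsum
  rw [hCc, hACc, hAcC, hAcCc]
  -- goal `β(rs) − β² ≤ α(rs) − α²` with `s = 1 - r`, i.e. `(α − β)(rs − α − β) ≥ 0`
  nlinarith [mul_nonneg (sub_nonneg.2 ht) (sub_nonneg.2 hs)]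

end OneCutFive

end Summit.CriticalPhenomena.PercolationContinuityZ3.Theorems
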